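import Summits.HubbardSuperconductivity.HubbardSuperconductivity.Theorems.NodalWardXYNodalReductionDefs
import Summits.HubbardSuperconductivity.HubbardSuperconductivity.Theorems.WeakCouplingBCSWcbcsBcsConstructionTrialStateSectors
import Literature.MathematicalPhysics.QuantumLattice.PairFieldMomentum

/-!
# `U(1)` selection rules: crux `NodalReduction` (stmt-HubbardSuperconductivity-1268), line `Sketch`, stub `stub_selectionRules`

Statement (D) `SelectionRules` of `NodalWardXYNodalReductionDefs`: for the `d`-wave pair field
`Δ = pairField dWaveFormFactor L` on the Hubbard torus `(ℤ/Lℤ)²`, the order operator `O = Δ + Δᴴ`, and ANY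
eigenvector `Φ` of the total particle number `N = totalNumber` (`NΦ = cΦ`, `c : ℂ`), the four expectations
`⟨Φ, OΦ⟩`, `⟨Φ, Δ²Φ⟩`, `⟨Φ, Δᴴ²Φ⟩`, `⟨Φ, O³Φ⟩` vanish (T. Koma, H. Tasaki, J. Stat. Phys. 76 (1994) 745,
eq. (2.18)). Reason: `[N, Δ] = -2Δ` and `[N, Δᴴ] = +2Δᴴ`, so a word `W₁ ⋯ W_k` in the letters `Δ, Δᴴ`
maps the `N`-eigenspace of `c` into that of `c + 2(#Δᴴ - #Δ)`, which is orthogonal to `Φ` unless the charge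
`2(#Δᴴ - #Δ)` vanishes — impossible for `Δ²`, `Δᴴ²` (charges `∓4`) and for the odd words making up `O` and
`O³` (charges `±2`, `±6`).

Content:

* `sel_mulVec_eq_re_smul`: the eigenvalue of a Hermitian matrix at an eigenvector is real, in the form
  `NΦ = cΦ → NΦ = (Re c)Φ` (true for `Φ = 0` as well), which converts the hypothesis of `SelectionRules`
  (`c : ℂ`) to the real-eigenvalue format of the landed charge bookkeeping;
* the charge bookkeeping itself is the landed `WcbcsTrialState` API of
  `Theorems/WeakCouplingBCSWcbcsBcsConstructionTrialStateSectors.lean` (`eigen_mulVec_of_commutator`,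
  `commutator_conjTranspose_of_commutator`, `star_dotProduct_eq_zero_of_eigen`,
  `star_dotProduct_charged_mulVec_eq_zero`, `star_charged_mulVec_dotProduct_eq_zero`), fed with
  `[N, Δ] = -2Δ` (`totalNumber_commutator_localPair` and `commutator_sum_eq_smul` of `PairFieldMomentum`,
  `Δ = Σ_x P_x`); for `⟨Φ, O³Φ⟩ = ⟨OΦ, O(OΦ)⟩` one factor `O` is moved across the inner product
  (`O` Hermitian, `isHermitian_pairField_add_conjTranspose` of `DWaveSource`).

Sources: T. Koma, H. Tasaki, J. Stat. Phys. 76 (1994) 745, eq. (2.18) and the proof of Thm 2.2; T. Koma,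
H. Tasaki, Commun. Math. Phys. 158 (1993) 191, §7. Design: no definitions; the only new general fact is the
reality of the eigenvalue, stated for an arbitrary finite index type in the tree's `dotProduct` language.
-/

noncomputable section

-- `Summit.HubbardSuperconductivity.HubbardSuperconductivity.…` is the tree's summit/sub-problem namespace (D-0017).
set_option linter.dupNamespace false

namespace Summit.HubbardSuperconductivity.HubbardSuperconductivity.Theorems.NodalReduction

open Matrix
open Literature.MathematicalPhysics.QuantumLattice Literature.Probability.LatticeModels
open WcbcsTrialState
open scoped ComplexOrder

/-- The eigenvalue of a Hermitian matrix at an eigenvector is real: `NΦ = cΦ` forces `NΦ = (Re c)Φ`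
(for `Φ ≠ 0`: `c‖Φ‖² = ⟨Φ, NΦ⟩ = ⟨NΦ, Φ⟩ = conj c ‖Φ‖²` and `‖Φ‖² ≠ 0`; for `Φ = 0` both sides vanish). -/
theorem sel_mulVec_eq_re_smul {m : Type*} [Fintype m] {N : Matrix m m ℂ} (hN : N.IsHermitian)
    {Φ : m → ℂ} {c : ℂ} (hΦ : N *ᵥ Φ = c • Φ) : N *ᵥ Φ = ((c.re : ℝ) : ℂ) • Φ := by
  by_cases h0 : Φ = 0
  · rw [h0, mulVec_zero, smul_zero]
  have h3 : star Φ ⬝ᵥ (N *ᵥ Φ) = star (N *ᵥ Φ) ⬝ᵥ Φ := star_dotProduct_mulVec_of_isHermitian hN Φ Φ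
  rw [hΦ, dotProduct_smul, star_smul, smul_dotProduct, smul_eq_mul, smul_eq_mul] at h3
  have hne : star Φ ⬝ᵥ Φ ≠ 0 := fun h => h0 (dotProduct_star_self_eq_zero.1 h)
  have hc : (starRingEnd ℂ) c = c := by
    have h := (mul_right_cancel₀ hne h3).symm
    rwa [Complex.star_def] at h
  rw [hΦ, Complex.conj_eq_iff_re.1 hc]

/-- **(D) `SelectionRules`** (Koma–Tasaki 1994, (2.18)): for `NΦ = cΦ` on the Hubbard torus and
`Δ = pairField dWaveFormFactor L`, `O = Δ + Δᴴ`: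
`⟨Φ, OΦ⟩ = ⟨Φ, Δ²Φ⟩ = ⟨Φ, Δᴴ²Φ⟩ = ⟨Φ, O³Φ⟩ = 0`. The eigenvalue is real (`sel_mulVec_eq_re_smul`),
`[N, Δ] = -2Δ`, `[N, Δᴴ] = 2Δᴴ`, so `ΔΦ, ΔᴴΦ, Δ²Φ, Δᴴ²Φ` are `N`-eigenvectors of eigenvalues
`Re c ∓ 2, Re c ∓ 4 ≠ Re c`, orthogonal to `Φ`; and `⟨Φ, O³Φ⟩ = ⟨OΦ, O(OΦ)⟩ = 0` is the cubic rule
`star_charged_mulVec_dotProduct_eq_zero` (`OΦ` has charges `±2`, `O(OΦ)` charges `0, ±4`). -/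
theorem stub_selectionRules : SelectionRules := by
  intro L _ Φ c hΦ
  dsimp only
  have hN : (totalNumber :
      Matrix (Finset (Orb (FermionTorus 2 L))) (Finset (Orb (FermionTorus 2 L))) ℂ).IsHermitian :=
    totalNumber_isHermitian
  have hv := sel_mulVec_eq_re_smul hN hΦ
  have hD : totalNumber * pairField dWaveFormFactor L - pairField dWaveFormFactor L * totalNumber =
      ((-2 : ℝ) : ℂ) • pairField dWaveFormFactor L := by
    rw [Complex.ofReal_neg, Complex.ofReal_ofNat]
    exact commutator_sum_eq_smul _ _ _ _ fun x _ =>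
      totalNumber_commutator_localPair dWaveFormFactor L x
  have hD' := commutator_conjTranspose_of_commutator hN hD
  refine ⟨star_dotProduct_charged_mulVec_eq_zero hN hD hv, ?_, ?_, ?_⟩
  · rw [← mulVec_mulVec]
    exact star_dotProduct_eq_zero_of_eigen hN hv
      (eigen_mulVec_of_commutator hD (eigen_mulVec_of_commutator hD hv)) (by linarith)
  · rw [← mulVec_mulVec]
    exact star_dotProduct_eq_zero_of_eigen hN hv
      (eigen_mulVec_of_commutator hD' (eigen_mulVec_of_commutator hD' hv)) (by linarith)
  · rw [← mulVec_mulVec, ← mulVec_mulVec,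
      star_dotProduct_mulVec_of_isHermitian (isHermitian_pairField_add_conjTranspose L)]
    exact star_charged_mulVec_dotProduct_eq_zero hN hD hv

end Summit.HubbardSuperconductivity.HubbardSuperconductivity.Theorems.NodalReduction

end
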